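import Summits.AnomalousDissipation.AnomalousDissipation.Theorems.MomentParityPathField
import Literature.Analysis.FluidPDE.StatisticalSolutionEnergyEq

/-!
# Crux `EnsembleRealization` (stmt-AnomalousDissipation-0215) — lines `augmented-lift` /
# `superposition-lift`, stub `stub_marginalMeans`: the two observables under the marginal identity

Let `Q` be a law on MomentParity's trajectory space `𝒦 = pathSpace R L` (`MomentParityDefs`) whose
one-time marginals — the laws of the coefficient vectors `k ↦ ω̄(t, k)`, `t ≥ 0` — are the
Fourier-coefficient law `u ↦ (k ↦ û(k))` of a stationary statistical solution `μ` on the energy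
space `H`.  Then

* `∫ energyMean dQ = ensembleEnergy μ`: Fubini on `[0, 1] × 𝒦` (the total energy `pathEnergyTot` is
  measurable and bounded by `R²` on `𝒦`), transport through the marginal identity at each fixed time
  in `ℝ≥0∞` (`lintegral_map`; the functional `c ↦ ∑' ‖c k‖ₑ²` is measurable on the countable
  product), and Parseval on `H`, `‖u‖ₑ² = ∑' ‖û(k)‖ₑ²` (`Torus.enorm_sq_coe_eq_tsum`);
* `∫ dissMean ν K dQ ↑ ensembleDissipation ν μ` as `K → ∞`: Fubini, transport of the (continuous)
  resolved enstrophy `ν 4π² ∑_{|k| ≤ K} |k|² ‖c k‖²`, and monotone convergence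
  `4π² ∑_{|k| ≤ K} |k|² ‖û(k)‖² ↑ ‖∇u‖₂²` under `μ` (`eGradNormSq_eq_tsum`, finite mean enstrophy
  (1.29), `lintegral_tendsto_of_tendsto_of_monotone`).

(Foias–Manley–Rosa–Temam 2001, Ch. IV (1.29), (1.32)–(1.34); the Fubini step is the pattern of
`MomentParityGalerkinEnsembleRealizationStubLevelDissMean`.)
-/

noncomputable section

-- every `Summit.AnomalousDissipation.AnomalousDissipation.…` name repeats the summit = sub-problem segment (D-0017 layout)
set_option linter.dupNamespace false

open MeasureTheory Set Filter Topology Function Metric UnitAddTorus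
open scoped BigOperators ENNReal InnerProductSpace RealInnerProductSpace

namespace Summit.AnomalousDissipation.AnomalousDissipation.Theorems.EnsembleRealization

open Literature.Analysis.FunctionSpaces Literature.Analysis.FunctionSpaces.Torus
open Literature.Analysis.FluidPDE Literature.Analysis.FluidPDE.Torus
open Summit.AnomalousDissipation.AnomalousDissipation.Theorems.MomentParity

variable {ν : ℝ} {f : UnitAddTorus (Fin 3) → EuclideanSpace ℝ (Fin 3)}
  {μ : Measure (Torus.energySpace (Fin 3))}

/-! ### Measurability of the two coefficient maps -/

/-- The coefficient map of the trajectory space at a fixed time, `ω ↦ (k ↦ ω̄(t, k))`, is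
measurable (coordinatewise continuous). -/
private theorem measurable_pathCoeff (R : ℝ) (L : (Fin 3 → ℤ) → ℝ) (t : ℝ) :
    Measurable fun ω : ↥(pathSpace R L : Set (Path (Fin 3))) => fun k : Fin 3 → ℤ => pathExt ω.1 t k :=
  measurable_pi_lambda _ fun k => (continuous_pathExt_subtype R L t k).measurable

/-- The Fourier-coefficient map of the energy space, `u ↦ (k ↦ û(k))`, is measurable (each
coefficient is a continuous functional on `L²`). -/
private theorem measurable_fieldCoeff :
    Measurable fun u : Torus.energySpace (Fin 3) => fun k : Fin 3 → ℤ =>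
      mFourierCoeff (EuclideanSpace.complexify ∘ (u.1 : UnitAddTorus (Fin 3) → EuclideanSpace ℝ (Fin 3))) k :=
  measurable_pi_lambda _ fun k =>
    ((continuous_mFourierCoeff_complexify_coe k).comp continuous_subtype_val).measurable

/-! ### The mean energy -/

/-- **Fubini for the mean total energy**: against a finite law on the trajectory space,
`∫ energyMean dQ = ∫₀¹ (∫ pathEnergyTot(·, t) dQ) dt` (the total energy is measurable on `𝒦 × ℝ`
and bounded by `R²`). -/
private theorem integral_energyMean_eq_intervalIntegral {R : ℝ} {L : (Fin 3 → ℤ) → ℝ}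
    (Q : Measure ↥(pathSpace R L : Set (Path (Fin 3)))) [IsFiniteMeasure Q] :
    ∫ ω, energyMean ω.1 ∂Q = ∫ t in (0 : ℝ)..1, ∫ ω, pathEnergyTot ω.1 t ∂Q := by
  unfold energyMean
  symm
  apply intervalIntegral_integral_swap
  rw [uIoc_of_le zero_le_one, Function.uncurry_def]
  have hmeas : Measurable fun p : ℝ × ↥(pathSpace R L : Set (Path (Fin 3))) =>
      pathEnergyTot p.2.1 p.1 := by
    have h := (measurable_pathEnergyTot R L).comp
      (measurable_swap (α := ℝ) (β := ↥(pathSpace R L : Set (Path (Fin 3)))))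
    exact h
  refine Integrable.of_bound hmeas.aestronglyMeasurable (R ^ 2) (ae_of_all _ fun p => ?_)
  rw [Real.norm_eq_abs, abs_of_nonneg (pathEnergyTot_nonneg _ _)]
  exact pathEnergyTot_le p.2.2 p.1

/-- **The mean total energy at a fixed time** `t ≥ 0`: `∫ pathEnergyTot(·, t) dQ = ensembleEnergy μ`
(both sides as `toReal` of lower Lebesgue integrals, transport through the marginal identity, and
Parseval `‖u‖ₑ² = ∑' ‖û(k)‖ₑ²` on `H`). -/
private theorem integral_pathEnergyTot_eq_ensembleEnergy {R : ℝ} {L : (Fin 3 → ℤ) → ℝ}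
    (Q : Measure ↥(pathSpace R L : Set (Path (Fin 3))))
    (hmarg : ∀ t, 0 ≤ t → Q.map (fun ω => fun k : Fin 3 → ℤ => pathExt ω.1 t k) =
      μ.map (fun u : Torus.energySpace (Fin 3) => fun k : Fin 3 → ℤ =>
        mFourierCoeff (EuclideanSpace.complexify ∘ (u.1 : UnitAddTorus (Fin 3) → EuclideanSpace ℝ (Fin 3))) k))
    {t : ℝ} (ht : 0 ≤ t) :
    ∫ ω, pathEnergyTot ω.1 t ∂Q = ensembleEnergy μ := by
  have hG : Measurable fun c : (Fin 3 → ℤ) → EuclideanSpace ℂ (Fin 3) => ∑' k, ‖c k‖ₑ ^ 2 :=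
    Measurable.tsum fun k => (measurable_pi_apply k).enorm.pow_const 2
  have hmeas : Measurable fun ω : ↥(pathSpace R L : Set (Path (Fin 3))) => pathEnergyTot ω.1 t := by
    have h := (measurable_pathEnergyTot R L).comp
      ((measurable_id (α := ↥(pathSpace R L : Set (Path (Fin 3))))).prodMk (measurable_const (a := t)))
    exact h
  have h0 : 0 ≤ᵐ[Q] fun ω : ↥(pathSpace R L : Set (Path (Fin 3))) => pathEnergyTot ω.1 t :=
    Eventually.of_forall fun ω => pathEnergyTot_nonneg ω.1 t
  have h1 : ∫ ω, pathEnergyTot ω.1 t ∂Q = (∫⁻ ω, ∑' k, ‖pathExt ω.1 t k‖ₑ ^ 2 ∂Q).toReal := by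
    rw [integral_eq_lintegral_of_nonneg_ae h0 hmeas.aestronglyMeasurable]
    congr 1
    refine lintegral_congr fun ω => ?_
    rw [pathEnergyTot, ENNReal.ofReal_tsum_of_nonneg (fun _ => sq_nonneg _)
      (summable_norm_pathExt_sq ω.2 t)]
    exact tsum_congr fun k => (enorm_sq_eq_ofReal_norm_sq _).symm
  have h0' : 0 ≤ᵐ[μ] fun u : Torus.energySpace (Fin 3) => ‖u‖ ^ 2 :=
    Eventually.of_forall fun u => sq_nonneg _
  have h2 : ensembleEnergy μ = (∫⁻ u, ‖u‖ₑ ^ 2 ∂μ).toReal := by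
    rw [ensembleEnergy, integral_eq_lintegral_of_nonneg_ae h0' (continuous_norm.pow 2).aestronglyMeasurable]
    congr 1
    exact lintegral_congr fun u => (enorm_sq_eq_ofReal_norm_sq u).symm
  rw [h1, h2]
  congr 1
  calc ∫⁻ ω, ∑' k, ‖pathExt ω.1 t k‖ₑ ^ 2 ∂Q
      = ∫⁻ c, ∑' k, ‖c k‖ₑ ^ 2 ∂(Q.map fun ω => fun k : Fin 3 → ℤ => pathExt ω.1 t k) :=
        (lintegral_map hG (measurable_pathCoeff R L t)).symm
    _ = ∫⁻ c, ∑' k, ‖c k‖ₑ ^ 2 ∂(μ.map fun u : Torus.energySpace (Fin 3) => fun k : Fin 3 → ℤ =>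
          mFourierCoeff (EuclideanSpace.complexify ∘
            (u.1 : UnitAddTorus (Fin 3) → EuclideanSpace ℝ (Fin 3))) k) := by
        rw [hmarg t ht]
    _ = ∫⁻ u, ∑' k, ‖mFourierCoeff (EuclideanSpace.complexify ∘
          ((u : Torus.energySpace (Fin 3)).1 : UnitAddTorus (Fin 3) → EuclideanSpace ℝ (Fin 3))) k‖ₑ ^ 2 ∂μ :=
        lintegral_map hG measurable_fieldCoeff
    _ = ∫⁻ u, ‖u‖ₑ ^ 2 ∂μ := lintegral_congr fun u => by
        have hn : ‖u‖ₑ = ‖(u.1 : Lp (EuclideanSpace ℝ (Fin 3)) 2 (volume : Measure (UnitAddTorus (Fin 3))))‖ₑ :=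
          rfl
        rw [hn, enorm_sq_coe_eq_tsum]

/-! ### The mean resolved dissipation -/

/-- **Fubini for the mean resolved dissipation** (the pattern of the sibling
`MomentParityGalerkinEnsembleRealizationStubLevelDissMean`): against a finite law on the trajectory
space, `∫ dissMean dQ = ∫₀¹ (∫ pathDiss(·, t) dQ) dt` (the integrand is continuous and bounded on
`𝒦 × ℝ`, `ν ≥ 0`). -/
private theorem integral_dissMean_eq_intervalIntegral {R : ℝ} {L : (Fin 3 → ℤ) → ℝ}
    (Q : Measure ↥(pathSpace R L : Set (Path (Fin 3)))) [IsFiniteMeasure Q] (hν : 0 ≤ ν) (K : ℕ) :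
    ∫ ω, dissMean ν K ω.1 ∂Q = ∫ t in (0 : ℝ)..1, ∫ ω, pathDiss ν K ω.1 t ∂Q := by
  -- adapted from MomentParity.integral_dissMean_eq_intervalIntegral (StubLevelDissMean)
  unfold dissMean
  symm
  apply intervalIntegral_integral_swap
  rw [uIoc_of_le zero_le_one, Function.uncurry_def]
  have hcont : Continuous fun p : ℝ × ↥(pathSpace R L : Set (Path (Fin 3))) =>
      pathDiss ν K p.2.1 p.1 := by
    have h := (continuous_pathDiss R L ν K).comp
      (continuous_swap (X := ℝ) (Y := ↥(pathSpace R L : Set (Path (Fin 3)))))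
    exact h
  refine Integrable.of_bound hcont.aestronglyMeasurable
    (ν * (4 * Real.pi ^ 2 * ((K : ℝ) ^ 2 * R ^ 2))) (ae_of_all _ fun p => ?_)
  rw [Real.norm_eq_abs, abs_of_nonneg (pathDiss_nonneg hν K _ _)]
  exact pathDiss_le hν K p.2.2 p.1

/-- **The mean resolved dissipation at a fixed time** `t ≥ 0`:
`∫ pathDiss ν K (·, t) dQ = ∫ ν 4π² ∑_{|k| ≤ K} |k|² ‖û(k)‖² dμ` (transport of a continuous
functional of the coefficients through the marginal identity). -/
private theorem integral_pathDiss_eq_integral {R : ℝ} {L : (Fin 3 → ℤ) → ℝ}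
    (Q : Measure ↥(pathSpace R L : Set (Path (Fin 3))))
    (hmarg : ∀ t, 0 ≤ t → Q.map (fun ω => fun k : Fin 3 → ℤ => pathExt ω.1 t k) =
      μ.map (fun u : Torus.energySpace (Fin 3) => fun k : Fin 3 → ℤ =>
        mFourierCoeff (EuclideanSpace.complexify ∘ (u.1 : UnitAddTorus (Fin 3) → EuclideanSpace ℝ (Fin 3))) k))
    (K : ℕ) {t : ℝ} (ht : 0 ≤ t) :
    ∫ ω, pathDiss ν K ω.1 t ∂Q = ∫ u, ν * (4 * Real.pi ^ 2 * ∑ k ∈ freqBall K, freqNormSq k *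
      ‖mFourierCoeff (EuclideanSpace.complexify ∘
        ((u : Torus.energySpace (Fin 3)).1 : UnitAddTorus (Fin 3) → EuclideanSpace ℝ (Fin 3))) k‖ ^ 2) ∂μ := by
  have hD : Continuous fun c : (Fin 3 → ℤ) → EuclideanSpace ℂ (Fin 3) =>
      ν * (4 * Real.pi ^ 2 * ∑ k ∈ freqBall K, freqNormSq k * ‖c k‖ ^ 2) := by
    refine continuous_const.mul (continuous_const.mul (continuous_finsetSum _ fun k _ => ?_))
    exact continuous_const.mul (((continuous_apply k).norm).pow 2)
  calc ∫ ω, pathDiss ν K ω.1 t ∂Q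
      = ∫ c, ν * (4 * Real.pi ^ 2 * ∑ k ∈ freqBall K, freqNormSq k * ‖c k‖ ^ 2)
          ∂(Q.map fun ω => fun k : Fin 3 → ℤ => pathExt ω.1 t k) :=
        (integral_map (measurable_pathCoeff R L t).aemeasurable hD.aestronglyMeasurable).symm
    _ = ∫ c, ν * (4 * Real.pi ^ 2 * ∑ k ∈ freqBall K, freqNormSq k * ‖c k‖ ^ 2)
          ∂(μ.map fun u : Torus.energySpace (Fin 3) => fun k : Fin 3 → ℤ =>
            mFourierCoeff (EuclideanSpace.complexify ∘
              (u.1 : UnitAddTorus (Fin 3) → EuclideanSpace ℝ (Fin 3))) k) := by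
        rw [hmarg t ht]
    _ = _ := integral_map measurable_fieldCoeff.aemeasurable hD.aestronglyMeasurable

/-- The resolved enstrophy in `ℝ≥0∞`:
`ofReal (4π² ∑_{k ∈ T} |k|² ‖c k‖²) = ofReal (4π²) ∑_{k ∈ T} ofReal |k|² ‖c k‖ₑ²`. -/
private theorem ofReal_resolvedEnstrophy (T : Finset (Fin 3 → ℤ))
    (c : (Fin 3 → ℤ) → EuclideanSpace ℂ (Fin 3)) :
    ENNReal.ofReal (4 * Real.pi ^ 2 * ∑ k ∈ T, freqNormSq k * ‖c k‖ ^ 2) =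
      ENNReal.ofReal (4 * Real.pi ^ 2) * ∑ k ∈ T, ENNReal.ofReal (freqNormSq k) * ‖c k‖ₑ ^ 2 := by
  rw [ENNReal.ofReal_mul (by positivity),
    ENNReal.ofReal_sum_of_nonneg fun k _ => mul_nonneg (freqNormSq_nonneg k) (sq_nonneg _)]
  congr 1
  exact Finset.sum_congr rfl fun k _ => by
    rw [ENNReal.ofReal_mul (freqNormSq_nonneg k), enorm_sq_eq_ofReal_norm_sq]

/-- **Monotone convergence of the resolved mean enstrophies**: under a stationary statistical
solution (finite mean enstrophy (1.29)), `∫ 4π² ∑_{|k| ≤ K} |k|² ‖û(k)‖² dμ → (ensembleEnstrophy μ).toReal`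
as `K → ∞` (the frequency balls exhaust `ℤ³` increasingly, `eGradNormSq_eq_tsum`). -/
private theorem tendsto_integral_resolvedEnstrophy (hμ : IsStationaryStatisticalSolution ν f μ) :
    Tendsto (fun K : ℕ => ∫ u, 4 * Real.pi ^ 2 * ∑ k ∈ freqBall K, freqNormSq k *
        ‖mFourierCoeff (EuclideanSpace.complexify ∘
          ((u : Torus.energySpace (Fin 3)).1 : UnitAddTorus (Fin 3) → EuclideanSpace ℝ (Fin 3))) k‖ ^ 2 ∂μ)
      atTop (𝓝 (ensembleEnstrophy μ).toReal) := by
  have hcoef : ∀ k : Fin 3 → ℤ, Continuous fun u : Torus.energySpace (Fin 3) =>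
      mFourierCoeff (EuclideanSpace.complexify ∘ (u.1 : UnitAddTorus (Fin 3) → EuclideanSpace ℝ (Fin 3))) k :=
    fun k => (continuous_mFourierCoeff_complexify_coe k).comp continuous_subtype_val
  -- the resolved enstrophies in `ℝ≥0∞`: measurable, increasing in `K`, converging to the enstrophy
  have hmeas : ∀ K : ℕ, Measurable fun u : Torus.energySpace (Fin 3) => ENNReal.ofReal (4 * Real.pi ^ 2) *
      ∑ k ∈ freqBall K, ENNReal.ofReal (freqNormSq k) *
        ‖mFourierCoeff (EuclideanSpace.complexify ∘
          (u.1 : UnitAddTorus (Fin 3) → EuclideanSpace ℝ (Fin 3))) k‖ₑ ^ 2 :=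
    fun K => (Finset.measurable_sum _ fun k _ =>
      ((hcoef k).measurable.enorm.pow_const 2).const_mul _).const_mul _
  have hlim : Tendsto (fun K : ℕ => ∫⁻ u, ENNReal.ofReal (4 * Real.pi ^ 2) *
      ∑ k ∈ freqBall K, ENNReal.ofReal (freqNormSq k) *
        ‖mFourierCoeff (EuclideanSpace.complexify ∘
          ((u : Torus.energySpace (Fin 3)).1 : UnitAddTorus (Fin 3) → EuclideanSpace ℝ (Fin 3))) k‖ₑ ^ 2 ∂μ)
      atTop (𝓝 (ensembleEnstrophy μ)) := by
    refine lintegral_tendsto_of_tendsto_of_monotone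
      (F := fun u : Torus.energySpace (Fin 3) =>
        eGradNormSq (u.1 : UnitAddTorus (Fin 3) → EuclideanSpace ℝ (Fin 3)))
      (fun K => (hmeas K).aemeasurable) (ae_of_all _ fun u => ?_) (ae_of_all _ fun u => ?_)
    · intro K K' hKK'
      exact mul_le_mul_right (Finset.sum_le_sum_of_subset (freqBall_mono hKK')) _
    · have hsum : HasSum (fun k : Fin 3 → ℤ => ENNReal.ofReal (freqNormSq k) *
          ‖mFourierCoeff (EuclideanSpace.complexify ∘
            (u.1 : UnitAddTorus (Fin 3) → EuclideanSpace ℝ (Fin 3))) k‖ₑ ^ 2) (∑' k, _) :=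
        ENNReal.summable.hasSum
      rw [eGradNormSq_eq_tsum]
      exact ENNReal.Tendsto.const_mul (hsum.comp tendsto_freqBall_atTop) (Or.inr ENNReal.ofReal_ne_top)
  -- identify the real integrals with the `toReal` of the lower integrals
  have h0 : ∀ K : ℕ, 0 ≤ᵐ[μ] fun u : Torus.energySpace (Fin 3) => 4 * Real.pi ^ 2 *
      ∑ k ∈ freqBall K, freqNormSq k * ‖mFourierCoeff (EuclideanSpace.complexify ∘
        (u.1 : UnitAddTorus (Fin 3) → EuclideanSpace ℝ (Fin 3))) k‖ ^ 2 :=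
    fun K => Eventually.of_forall fun u => mul_nonneg (by positivity)
      (Finset.sum_nonneg fun k _ => mul_nonneg (freqNormSq_nonneg k) (sq_nonneg _))
  have hm : ∀ K : ℕ, AEStronglyMeasurable (fun u : Torus.energySpace (Fin 3) => 4 * Real.pi ^ 2 *
      ∑ k ∈ freqBall K, freqNormSq k * ‖mFourierCoeff (EuclideanSpace.complexify ∘
        (u.1 : UnitAddTorus (Fin 3) → EuclideanSpace ℝ (Fin 3))) k‖ ^ 2) μ :=
    fun K => (continuous_const.mul (continuous_finsetSum _ fun k _ =>
      continuous_const.mul (((hcoef k).norm).pow 2))).aestronglyMeasurable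
  refine ((ENNReal.tendsto_toReal hμ.enstrophy_finite.ne).comp hlim).congr fun K => ?_
  rw [Function.comp_apply, integral_eq_lintegral_of_nonneg_ae (h0 K) (hm K)]
  exact congr_arg ENNReal.toReal (lintegral_congr fun u => (ofReal_resolvedEnstrophy _ _).symm)

/-! ### The stub -/

/-- **Stub (marginal means).** If the one-time marginals of a law `Q` on `𝒦` are the coefficient
law of a stationary statistical solution `μ`, then `∫ energyMean dQ = ensembleEnergy μ` (Fubini in
`(ω, t) ∈ 𝒦 × [0,1]` and Parseval) and the mean resolved dissipation `∫ dissMean ν K dQ` increases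
to `ensembleDissipation ν μ` as `K → ∞` (monotone convergence, finite mean enstrophy (1.29)).
[FMRTTurbulence2001 IV (1.29), (1.32)–(1.34)] -/
theorem stub_marginalMeans (hν : 0 < ν) (hμ : IsStationaryStatisticalSolution ν f μ) {R : ℝ}
    {L : (Fin 3 → ℤ) → ℝ} (Q : Measure ↥(pathSpace R L : Set (Path (Fin 3)))) [IsProbabilityMeasure Q]
    (hmarg : ∀ t, 0 ≤ t → Q.map (fun ω => fun k : Fin 3 → ℤ => pathExt ω.1 t k) =
      μ.map (fun u : Torus.energySpace (Fin 3) => fun k : Fin 3 → ℤ =>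
        mFourierCoeff (EuclideanSpace.complexify ∘ (u.1 : UnitAddTorus (Fin 3) → EuclideanSpace ℝ (Fin 3))) k)) :
    ∫ ω, energyMean ω.1 ∂Q = ensembleEnergy μ ∧
      ∀ δ, 0 < δ → ∃ K : ℕ, ensembleDissipation ν μ - δ ≤ ∫ ω, dissMean ν K ω.1 ∂Q := by
  refine ⟨?_, fun δ hδ => ?_⟩
  · -- the mean energy: Fubini, then the fixed-time identity at every `t ∈ [0, 1]`
    rw [integral_energyMean_eq_intervalIntegral Q,
      intervalIntegral.integral_congr (g := fun _ => ensembleEnergy μ) fun t ht => ?_]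
    · simp
    · rw [uIcc_of_le zero_le_one] at ht
      exact integral_pathEnergyTot_eq_ensembleEnergy Q hmarg ht.1
  · -- the mean resolved dissipation is `ν ×` the resolved mean enstrophy of `μ` ...
    have hK : ∀ K : ℕ, ∫ ω, dissMean ν K ω.1 ∂Q = ν * ∫ u, 4 * Real.pi ^ 2 *
        ∑ k ∈ freqBall K, freqNormSq k * ‖mFourierCoeff (EuclideanSpace.complexify ∘
          ((u : Torus.energySpace (Fin 3)).1 : UnitAddTorus (Fin 3) → EuclideanSpace ℝ (Fin 3))) k‖ ^ 2 ∂μ := by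
      intro K
      rw [integral_dissMean_eq_intervalIntegral Q hν.le K,
        intervalIntegral.integral_congr (g := fun _ => ν * ∫ u, 4 * Real.pi ^ 2 *
          ∑ k ∈ freqBall K, freqNormSq k * ‖mFourierCoeff (EuclideanSpace.complexify ∘
            ((u : Torus.energySpace (Fin 3)).1 : UnitAddTorus (Fin 3) → EuclideanSpace ℝ (Fin 3))) k‖ ^ 2 ∂μ)
          fun t ht => ?_]
      · simp
      · rw [uIcc_of_le zero_le_one] at ht
        beta_reduce
        rw [integral_pathDiss_eq_integral Q hmarg K ht.1, integral_const_mul]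
    -- ... which increases to the mean enstrophy
    have hlim : Tendsto (fun K : ℕ => ∫ ω, dissMean ν K ω.1 ∂Q) atTop (𝓝 (ensembleDissipation ν μ)) := by
      rw [show (fun K : ℕ => ∫ ω, dissMean ν K ω.1 ∂Q) = _ from funext hK]
      exact (tendsto_integral_resolvedEnstrophy hμ).const_mul ν
    obtain ⟨K, hK'⟩ := (hlim.eventually (lt_mem_nhds (sub_lt_self _ hδ))).exists
    exact ⟨K, hK'.le⟩

end Summit.AnomalousDissipation.AnomalousDissipation.Theorems.EnsembleRealization
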